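import Summits.Ventures.CertifiedManyBodySolver.Observables.PairLROTowerChargedReadingTwistedFlip
import Summits.Ventures.CertifiedManyBodySolver.Observables.PairLROTowerChargedCells
import HarnessLib

/-!
# OP1-C, part 13: cell / cover leaves for TWISTED and FLIP-TWISTED OP1-C orbit-state nodes (the port of
# hubbard-obs-lit's PairLROTowerChargedLeafCells to the identification classes of eng-2's one-point objects)

HONEST FRAMING: first certified bounds on pairing observables; not a superconductivity verdict; a ceiling route,
never presence; nothing in this file is a number. Crew hubbard-obs (D-0042), seat hubbard-obs-p1
(`prover-hubbard-obs-p1-g9-0`); lead RULINGS (eo) d181 / (ex) d190 / (fa) d193. Zero compute; no definition; no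
named fact; no `sorry`.

`ObsPairLROCeilingAt_of_onePoint_charged_orbitState_gridCells_bound_sq` / `…_near_of_cover` (PairLROTowerChargedLeafCells,
hubbard-obs-lit g7) take one D₂-type orbit-state OP1-C certificate per μ-cell. The Stage-B cell certificates of
sr-mbsolver-menu-3 are produced on the B0-class object under the FLIP-TWISTED identification (`obsb.py` «gauge_twist,
spin_flip»), whose nodes read through PairLROTowerChargedReadingTwisted[Flip]. This file supplies the same two cell
consumers for those node shapes:

* `ObsPairLROCeilingAt_of_onePoint_charged_twisted_orbitState_gridCells_bound_sq` / `…_twisted_orbitState_near_of_cover`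
  — twisted `D₄` family `twistedSpaceGroupUnitary S` (any `S ≠ ∅`, spin-resolved filling rows `μ_{jσ}`);
* `ObsPairLROCeilingAt_of_onePoint_charged_twistedFlip_orbitState_gridCells_bound_sq` /
  `…_twistedFlip_orbitState_near_of_cover` — flip-twisted family `twistedFlipSpaceGroupUnitary S` (any `S ≠ ∅`, ONE
  total-filling row `μ₀_j(Re⟨ζ,N̂ζ⟩/L² − ν₀_j)` per cell); conclusion `ObsPairLROCeilingAt t′ U n c′` at every
  `c′ ≥ max_j (c_j − Δ_j C_{q,j} − A_j + μ₀_j(n − ν₀_j))²`.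

* §3 (append): `…_gridCells_bound_sq_reprice` ×2 — the cell-level FAST LAYER: the same nodes re-priced under any
  later certified cap `e₀ ≤ hi` (leaf at `max_j (… + κ_j(u_j − hi))²`, zero new solves).
* §4 (append): `…_twistedFlip_orbitState_exactCells_bound_sq` (+ `…_twisted_…` twin) — per-cell nodes valid at EVERY `μ_c` of the cell
  (the δ-LIFT form of sr-mbsolver-menu-3 §8.5): leaf at `max_j (c_j − A_j + μ₀_j(n − ν₀_j))²`, no `Δ·C_q`.

Grid form: monotone `m : Fin (J+2) → ℝ` with `m 0 ≤ μ₋(n)`, `μ₊(n) ≤ m (Fin.last (J+1))` (at A0′ by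
`chemPotBracket_U8_n7o8_tp0_decimal_of_r498_r473_r472`), cells `[μ′_j − Δ_j, μ′_j + Δ_j] ⊇ [m j, m (j+1)]`.
CONDITIONAL on the claim nodes and the bracket fed in; a ceiling never speaks to presence.
References: T. Koma, H. Tasaki, J. Stat. Phys. 76 (1994) 745, Theorem 5 [KomaTasaki1994]; D. Ruelle, *Statistical
Mechanics* (1969) §3.4 [Ruelle1969]; E. H. Lieb, F. Y. Wu, Physica A 321 (2003) 1, §7 [LiebWuPhysicaA2003].
-/

noncomputable section

namespace Summit.Ventures.CertifiedManyBodySolver.Observables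

open Matrix Complex Finset Literature.MathematicalPhysics.QuantumLattice Literature.Probability.LatticeModels
open Literature.MathematicalPhysics.QuantumLattice.HubbardWave0 ThermodynamicLimit Filter Topology
open Literature.MathematicalPhysics.QuantumManyBody.StateRelaxation
open Summit.Ventures.CertifiedManyBodySolver.Transport
open scoped ComplexOrder ComplexConjugate BigOperators Matrix.Norms.L2Operator

section LeafCellsTwisted

variable {tp U n : ℝ} {hi c' : ℚ}

/-! ### §1 Twisted `D₄` family -/

/-- **TWISTED OP1-C ORBIT-STATE CELL LEAF (producer form).** As
`ObsPairLROCeilingAt_of_onePoint_charged_orbitState_gridCells_bound_sq` with the twisted family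
`twistedSpaceGroupUnitary S` in every cell's node and NO `b1gSign` hypothesis on `S ≠ ∅`.
[cite: KomaTasaki1994, Theorem 5] [cite: Ruelle1969, §3.4] [cite: LiebWuPhysicaA2003, §7] -/
theorem ObsPairLROCeilingAt_of_onePoint_charged_twisted_orbitState_gridCells_bound_sq (hU : 0 ≤ U) (hn0 : 0 < n)
    (hn2 : n < 2) (hE : energyDensityTT' 1 tp U n ≤ ((hi : ℚ) : ℝ)) {J : ℕ} (m : Fin (J + 2) → ℝ) (hm : Monotone m)
    (hlo : m 0 ≤ chemPotMinusTT' 1 tp U n) (hhi' : chemPotPlusTT' 1 tp U n ≤ m (Fin.last (J + 1)))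
    (μ' Δ : Fin (J + 1) → ℝ) (hleft : ∀ j, μ' j - Δ j ≤ m j.castSucc) (hright : ∀ j, m j.succ ≤ μ' j + Δ j)
    (c A κ u ν Cq : Fin (J + 1) → ℝ) (μ : Fin (J + 1) → Fin 2 → ℝ) (hκ : ∀ j, 0 ≤ κ j)
    (hhi : ∀ j, ((hi : ℚ) : ℝ) ≤ u j)
    {S : Finset (DihedralGroup 4)} (hS : S.Nonempty)
    {Λ' : Finset (Site 2)} (h0 : pairRegion (insert (0 : Site 2) unitSteps) 0 ⊆ Λ')
    (X : Fin (J + 1) → FermionOp Λ')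
    (hXeven : ∀ j, X j ∈ carEvenSubalgebra (Finset.univ : Finset (Orb (PolySite Λ'))))
    (hXevenH : ∀ j, (X j)ᴴ ∈ carEvenSubalgebra (Finset.univ : Finset (Orb (PolySite Λ'))))
    (hXq : ∀ j, ‖(totalNumberOp : FermionOp Λ') * X j - X j * totalNumberOp‖ ≤ Cq j) (L₁ : ℕ)
    (hInj : ∀ L : ℕ, L₁ ≤ L → Set.InjOn (Torus.proj (d := 2) L) ↑Λ')
    (hbound : ∀ j, ∀ (L : ℕ) [NeZero L] (hL : L₁ ≤ L) (ζ : Fock (Orb (FermionTorus 2 L))), star ζ ⬝ᵥ ζ = 1 →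
      c j - A j + ∑ σ : Fin 2, μ j σ *
          ((star ζ ⬝ᵥ ((∑ y : FermionTorus 2 L, numberOp y σ) *ᵥ ζ)).re / (L : ℝ) ^ 2 - ν j) +
        κ j * (u j - (star ζ ⬝ᵥ (hubbardTorusTT' L 1 tp U *ᵥ ζ)).re / (L : ℝ) ^ 2) +
        (orbitState (twistedSpaceGroupUnitary S) ζ
          ((hubbardTorusTT' L 1 tp U - (μ' j : ℂ) • totalNumber) * fermionEmbed (PolySite.toTorusEmb L (hInj L hL)) (X j) -
            fermionEmbed (PolySite.toTorusEmb L (hInj L hL)) (X j) *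
              (hubbardTorusTT' L 1 tp U - (μ' j : ℂ) • totalNumber))).re ≤
        (orbitState (twistedSpaceGroupUnitary S) ζ (fermionEmbed (PolySite.toTorusEmb L (hInj L hL))
          (-(fermionEmbed (PolySite.incl h0)
            (localPairAt (insert (0 : Site 2) unitSteps) dWaveFormFactor 0))))).re)
    (hc' : ∀ j, (c j - Δ j * Cq j - A j + (∑ σ : Fin 2, μ j σ) * (n / 2 - ν j)) ^ 2 ≤ ((c' : ℚ) : ℝ)) :
    ObsPairLROCeilingAt tp U n c' := by
  have hmp := chemPotMinusTT'_le_chemPotPlusTT' 1 tp hU hn0 hn2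
  obtain ⟨j, hj⟩ := exists_mem_Icc_castSucc_succ_of_monotone hm
    (x := chemPotMinusTT' 1 tp U n) ⟨hlo, hmp.trans hhi'⟩
  have hnear : |μ' j - chemPotMinusTT' 1 tp U n| ≤ Δ j :=
    abs_sub_le_iff.2 ⟨by linarith [hj.1, hleft j], by linarith [hj.2, hright j]⟩
  intro ψ hψ hψ1
  exact (liminf_pairFieldLRO_le_sq_of_onePoint_chargedStationary_twisted_orbitState_bound_TT'_near 1 tp hU hn0 hn2
    (μ j) (hκ j) (hE.trans (hhi j)) ⟨le_rfl, hmp⟩ hnear hS h0 (X j) (hXeven j) (hXevenH j) (hXq j) L₁ hInj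
    (hbound j) ψ hψ hψ1).trans (hc' j)

/-- **TWISTED OP1-C ORBIT-STATE ENVELOPE over a cover** (any family of grid cells whose union contains a bracket
`[μ_lo, μ_hi] ⊇ [μ₋(n), μ₊(n)]`). [cite: KomaTasaki1994, Theorem 5] [cite: Ruelle1969, §3.4] [cite: LiebWuPhysicaA2003, §7] -/
theorem ObsPairLROCeilingAt_of_onePoint_charged_twisted_orbitState_near_of_cover (hU : 0 ≤ U) (hn0 : 0 < n)
    (hn2 : n < 2) (hE : energyDensityTT' 1 tp U n ≤ ((hi : ℚ) : ℝ)) {μlo μhi : ℝ}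
    (hlo : μlo ≤ chemPotMinusTT' 1 tp U n) (hhi' : chemPotPlusTT' 1 tp U n ≤ μhi)
    {ι : Type*} (μ' Δ : ι → ℝ) (hcover : Set.Icc μlo μhi ⊆ ⋃ i, Set.Icc (μ' i - Δ i) (μ' i + Δ i))
    (c A κ u ν Cq : ι → ℝ) (μ : ι → Fin 2 → ℝ) (hκ : ∀ i, 0 ≤ κ i) (hhi : ∀ i, ((hi : ℚ) : ℝ) ≤ u i)
    {S : Finset (DihedralGroup 4)} (hS : S.Nonempty)
    {Λ' : Finset (Site 2)} (h0 : pairRegion (insert (0 : Site 2) unitSteps) 0 ⊆ Λ')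
    (X : ι → FermionOp Λ')
    (hXeven : ∀ i, X i ∈ carEvenSubalgebra (Finset.univ : Finset (Orb (PolySite Λ'))))
    (hXevenH : ∀ i, (X i)ᴴ ∈ carEvenSubalgebra (Finset.univ : Finset (Orb (PolySite Λ'))))
    (hXq : ∀ i, ‖(totalNumberOp : FermionOp Λ') * X i - X i * totalNumberOp‖ ≤ Cq i) (L₁ : ℕ)
    (hInj : ∀ L : ℕ, L₁ ≤ L → Set.InjOn (Torus.proj (d := 2) L) ↑Λ')
    (hbound : ∀ i, ∀ (L : ℕ) [NeZero L] (hL : L₁ ≤ L) (ζ : Fock (Orb (FermionTorus 2 L))), star ζ ⬝ᵥ ζ = 1 →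
      c i - A i + ∑ σ : Fin 2, μ i σ *
          ((star ζ ⬝ᵥ ((∑ y : FermionTorus 2 L, numberOp y σ) *ᵥ ζ)).re / (L : ℝ) ^ 2 - ν i) +
        κ i * (u i - (star ζ ⬝ᵥ (hubbardTorusTT' L 1 tp U *ᵥ ζ)).re / (L : ℝ) ^ 2) +
        (orbitState (twistedSpaceGroupUnitary S) ζ
          ((hubbardTorusTT' L 1 tp U - (μ' i : ℂ) • totalNumber) * fermionEmbed (PolySite.toTorusEmb L (hInj L hL)) (X i) -
            fermionEmbed (PolySite.toTorusEmb L (hInj L hL)) (X i) *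
              (hubbardTorusTT' L 1 tp U - (μ' i : ℂ) • totalNumber))).re ≤
        (orbitState (twistedSpaceGroupUnitary S) ζ (fermionEmbed (PolySite.toTorusEmb L (hInj L hL))
          (-(fermionEmbed (PolySite.incl h0)
            (localPairAt (insert (0 : Site 2) unitSteps) dWaveFormFactor 0))))).re)
    (hc' : ∀ i, (c i - Δ i * Cq i - A i + (∑ σ : Fin 2, μ i σ) * (n / 2 - ν i)) ^ 2 ≤ ((c' : ℚ) : ℝ)) :
    ObsPairLROCeilingAt tp U n c' := by
  have hmp := chemPotMinusTT'_le_chemPotPlusTT' 1 tp hU hn0 hn2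
  obtain ⟨i, hi⟩ := Set.mem_iUnion.1 (hcover ⟨hlo, hmp.trans hhi'⟩)
  have hnear : |μ' i - chemPotMinusTT' 1 tp U n| ≤ Δ i :=
    abs_sub_le_iff.2 ⟨by linarith [hi.1], by linarith [hi.2]⟩
  intro ψ hψ hψ1
  exact (liminf_pairFieldLRO_le_sq_of_onePoint_chargedStationary_twisted_orbitState_bound_TT'_near 1 tp hU hn0 hn2
    (μ i) (hκ i) (hE.trans (hhi i)) ⟨le_rfl, hmp⟩ hnear hS h0 (X i) (hXeven i) (hXevenH i) (hXq i) L₁ hInj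
    (hbound i) ψ hψ hψ1).trans (hc' i)

/-! ### §2 Flip-twisted `D₄ × flip` family (the B0 / E3 / UNION identification class) -/

/-- **FLIP-TWISTED OP1-C ORBIT-STATE CELL LEAF (producer form).** As the twisted cell leaf, with the flip-twisted
family `twistedFlipSpaceGroupUnitary S` and ONE total-filling row `μ₀_j(Re⟨ζ,N̂ζ⟩/L² − ν₀_j)` per cell; conclusion
`ObsPairLROCeilingAt t′ U n c′` at every `c′ ≥ max_j (c_j − Δ_j C_{q,j} − A_j + μ₀_j(n − ν₀_j))²`.
[cite: KomaTasaki1994, Theorem 5] [cite: Ruelle1969, §3.4] [cite: LiebWuPhysicaA2003, §7] -/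
theorem ObsPairLROCeilingAt_of_onePoint_charged_twistedFlip_orbitState_gridCells_bound_sq (hU : 0 ≤ U)
    (hn0 : 0 < n) (hn2 : n < 2) (hE : energyDensityTT' 1 tp U n ≤ ((hi : ℚ) : ℝ)) {J : ℕ} (m : Fin (J + 2) → ℝ)
    (hm : Monotone m) (hlo : m 0 ≤ chemPotMinusTT' 1 tp U n) (hhi' : chemPotPlusTT' 1 tp U n ≤ m (Fin.last (J + 1)))
    (μ' Δ : Fin (J + 1) → ℝ) (hleft : ∀ j, μ' j - Δ j ≤ m j.castSucc) (hright : ∀ j, m j.succ ≤ μ' j + Δ j)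
    (c A κ u μ₀ ν₀ Cq : Fin (J + 1) → ℝ) (hκ : ∀ j, 0 ≤ κ j) (hhi : ∀ j, ((hi : ℚ) : ℝ) ≤ u j)
    {S : Finset (DihedralGroup 4)} (hS : S.Nonempty)
    {Λ' : Finset (Site 2)} (h0 : pairRegion (insert (0 : Site 2) unitSteps) 0 ⊆ Λ')
    (X : Fin (J + 1) → FermionOp Λ')
    (hXeven : ∀ j, X j ∈ carEvenSubalgebra (Finset.univ : Finset (Orb (PolySite Λ'))))
    (hXevenH : ∀ j, (X j)ᴴ ∈ carEvenSubalgebra (Finset.univ : Finset (Orb (PolySite Λ'))))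
    (hXq : ∀ j, ‖(totalNumberOp : FermionOp Λ') * X j - X j * totalNumberOp‖ ≤ Cq j) (L₁ : ℕ)
    (hInj : ∀ L : ℕ, L₁ ≤ L → Set.InjOn (Torus.proj (d := 2) L) ↑Λ')
    (hbound : ∀ j, ∀ (L : ℕ) [NeZero L] (hL : L₁ ≤ L) (ζ : Fock (Orb (FermionTorus 2 L))), star ζ ⬝ᵥ ζ = 1 →
      c j - A j + μ₀ j * ((star ζ ⬝ᵥ ((totalNumber : Matrix (Finset (Orb (FermionTorus 2 L))) _ ℂ) *ᵥ ζ)).re /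
          (L : ℝ) ^ 2 - ν₀ j) +
        κ j * (u j - (star ζ ⬝ᵥ (hubbardTorusTT' L 1 tp U *ᵥ ζ)).re / (L : ℝ) ^ 2) +
        (orbitState (twistedFlipSpaceGroupUnitary S) ζ
          ((hubbardTorusTT' L 1 tp U - (μ' j : ℂ) • totalNumber) * fermionEmbed (PolySite.toTorusEmb L (hInj L hL)) (X j) -
            fermionEmbed (PolySite.toTorusEmb L (hInj L hL)) (X j) *
              (hubbardTorusTT' L 1 tp U - (μ' j : ℂ) • totalNumber))).re ≤
        (orbitState (twistedFlipSpaceGroupUnitary S) ζ (fermionEmbed (PolySite.toTorusEmb L (hInj L hL))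
          (-(fermionEmbed (PolySite.incl h0)
            (localPairAt (insert (0 : Site 2) unitSteps) dWaveFormFactor 0))))).re)
    (hc' : ∀ j, (c j - Δ j * Cq j - A j + μ₀ j * (n - ν₀ j)) ^ 2 ≤ ((c' : ℚ) : ℝ)) :
    ObsPairLROCeilingAt tp U n c' := by
  have hmp := chemPotMinusTT'_le_chemPotPlusTT' 1 tp hU hn0 hn2
  obtain ⟨j, hj⟩ := exists_mem_Icc_castSucc_succ_of_monotone hm
    (x := chemPotMinusTT' 1 tp U n) ⟨hlo, hmp.trans hhi'⟩
  have hnear : |μ' j - chemPotMinusTT' 1 tp U n| ≤ Δ j :=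
    abs_sub_le_iff.2 ⟨by linarith [hj.1, hleft j], by linarith [hj.2, hright j]⟩
  intro ψ hψ hψ1
  exact (liminf_pairFieldLRO_le_sq_of_onePoint_chargedStationary_twistedFlip_orbitState_bound_TT'_near 1 tp hU hn0
    hn2 (hκ j) (hE.trans (hhi j)) ⟨le_rfl, hmp⟩ hnear hS h0 (X j) (hXeven j) (hXevenH j) (hXq j) L₁ hInj
    (hbound j) ψ hψ hψ1).trans (hc' j)

/-- **FLIP-TWISTED OP1-C ORBIT-STATE ENVELOPE over a cover** (any family of grid cells whose union contains a bracket
`[μ_lo, μ_hi] ⊇ [μ₋(n), μ₊(n)]`). [cite: KomaTasaki1994, Theorem 5] [cite: Ruelle1969, §3.4] [cite: LiebWuPhysicaA2003, §7] -/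
theorem ObsPairLROCeilingAt_of_onePoint_charged_twistedFlip_orbitState_near_of_cover (hU : 0 ≤ U) (hn0 : 0 < n)
    (hn2 : n < 2) (hE : energyDensityTT' 1 tp U n ≤ ((hi : ℚ) : ℝ)) {μlo μhi : ℝ}
    (hlo : μlo ≤ chemPotMinusTT' 1 tp U n) (hhi' : chemPotPlusTT' 1 tp U n ≤ μhi)
    {ι : Type*} (μ' Δ : ι → ℝ) (hcover : Set.Icc μlo μhi ⊆ ⋃ i, Set.Icc (μ' i - Δ i) (μ' i + Δ i))
    (c A κ u μ₀ ν₀ Cq : ι → ℝ) (hκ : ∀ i, 0 ≤ κ i) (hhi : ∀ i, ((hi : ℚ) : ℝ) ≤ u i)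
    {S : Finset (DihedralGroup 4)} (hS : S.Nonempty)
    {Λ' : Finset (Site 2)} (h0 : pairRegion (insert (0 : Site 2) unitSteps) 0 ⊆ Λ')
    (X : ι → FermionOp Λ')
    (hXeven : ∀ i, X i ∈ carEvenSubalgebra (Finset.univ : Finset (Orb (PolySite Λ'))))
    (hXevenH : ∀ i, (X i)ᴴ ∈ carEvenSubalgebra (Finset.univ : Finset (Orb (PolySite Λ'))))
    (hXq : ∀ i, ‖(totalNumberOp : FermionOp Λ') * X i - X i * totalNumberOp‖ ≤ Cq i) (L₁ : ℕ)
    (hInj : ∀ L : ℕ, L₁ ≤ L → Set.InjOn (Torus.proj (d := 2) L) ↑Λ')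
    (hbound : ∀ i, ∀ (L : ℕ) [NeZero L] (hL : L₁ ≤ L) (ζ : Fock (Orb (FermionTorus 2 L))), star ζ ⬝ᵥ ζ = 1 →
      c i - A i + μ₀ i * ((star ζ ⬝ᵥ ((totalNumber : Matrix (Finset (Orb (FermionTorus 2 L))) _ ℂ) *ᵥ ζ)).re /
          (L : ℝ) ^ 2 - ν₀ i) +
        κ i * (u i - (star ζ ⬝ᵥ (hubbardTorusTT' L 1 tp U *ᵥ ζ)).re / (L : ℝ) ^ 2) +
        (orbitState (twistedFlipSpaceGroupUnitary S) ζ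
          ((hubbardTorusTT' L 1 tp U - (μ' i : ℂ) • totalNumber) * fermionEmbed (PolySite.toTorusEmb L (hInj L hL)) (X i) -
            fermionEmbed (PolySite.toTorusEmb L (hInj L hL)) (X i) *
              (hubbardTorusTT' L 1 tp U - (μ' i : ℂ) • totalNumber))).re ≤
        (orbitState (twistedFlipSpaceGroupUnitary S) ζ (fermionEmbed (PolySite.toTorusEmb L (hInj L hL))
          (-(fermionEmbed (PolySite.incl h0)
            (localPairAt (insert (0 : Site 2) unitSteps) dWaveFormFactor 0))))).re)
    (hc' : ∀ i, (c i - Δ i * Cq i - A i + μ₀ i * (n - ν₀ i)) ^ 2 ≤ ((c' : ℚ) : ℝ)) :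
    ObsPairLROCeilingAt tp U n c' := by
  have hmp := chemPotMinusTT'_le_chemPotPlusTT' 1 tp hU hn0 hn2
  obtain ⟨i, hi⟩ := Set.mem_iUnion.1 (hcover ⟨hlo, hmp.trans hhi'⟩)
  have hnear : |μ' i - chemPotMinusTT' 1 tp U n| ≤ Δ i :=
    abs_sub_le_iff.2 ⟨by linarith [hi.1], by linarith [hi.2]⟩
  intro ψ hψ hψ1
  exact (liminf_pairFieldLRO_le_sq_of_onePoint_chargedStationary_twistedFlip_orbitState_bound_TT'_near 1 tp hU hn0
    hn2 (hκ i) (hE.trans (hhi i)) ⟨le_rfl, hmp⟩ hnear hS h0 (X i) (hXeven i) (hXevenH i) (hXq i) L₁ hInj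
    (hbound i) ψ hψ hψ1).trans (hc' i)


/-! ### §3 (append) THE FAST LAYER for flip-twisted cell leaves: re-pricing every cell under a later cap -/

/-- **FLIP-TWISTED OP1-C CELL LEAF, RE-PRICED under ANY certified cap `e₀ ≤ hi`** (the one-point fast layer at the
cell level): the same per-cell nodes (written with the cells' own caps `u_j`, energy multipliers `κ_j ≥ 0`) give
`ObsPairLROCeilingAt t′ U n c′` at every `c′ ≥ max_j (c_j − Δ_j C_{q,j} − A_j + μ₀_j(n − ν₀_j) + κ_j(u_j − hi))²` — zero
new solves when the energy cap improves. [cite: KomaTasaki1994, Theorem 5] [cite: Ruelle1969, §3.4] -/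
theorem ObsPairLROCeilingAt_of_onePoint_charged_twistedFlip_orbitState_gridCells_bound_sq_reprice (hU : 0 ≤ U)
    (hn0 : 0 < n) (hn2 : n < 2) (hE : energyDensityTT' 1 tp U n ≤ ((hi : ℚ) : ℝ)) {J : ℕ} (m : Fin (J + 2) → ℝ)
    (hm : Monotone m) (hlo : m 0 ≤ chemPotMinusTT' 1 tp U n) (hhi' : chemPotPlusTT' 1 tp U n ≤ m (Fin.last (J + 1)))
    (μ' Δ : Fin (J + 1) → ℝ) (hleft : ∀ j, μ' j - Δ j ≤ m j.castSucc) (hright : ∀ j, m j.succ ≤ μ' j + Δ j)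
    (c A κ u μ₀ ν₀ Cq : Fin (J + 1) → ℝ) (hκ : ∀ j, 0 ≤ κ j)
    {S : Finset (DihedralGroup 4)} (hS : S.Nonempty)
    {Λ' : Finset (Site 2)} (h0 : pairRegion (insert (0 : Site 2) unitSteps) 0 ⊆ Λ')
    (X : Fin (J + 1) → FermionOp Λ')
    (hXeven : ∀ j, X j ∈ carEvenSubalgebra (Finset.univ : Finset (Orb (PolySite Λ'))))
    (hXevenH : ∀ j, (X j)ᴴ ∈ carEvenSubalgebra (Finset.univ : Finset (Orb (PolySite Λ'))))
    (hXq : ∀ j, ‖(totalNumberOp : FermionOp Λ') * X j - X j * totalNumberOp‖ ≤ Cq j) (L₁ : ℕ)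
    (hInj : ∀ L : ℕ, L₁ ≤ L → Set.InjOn (Torus.proj (d := 2) L) ↑Λ')
    (hbound : ∀ j, ∀ (L : ℕ) [NeZero L] (hL : L₁ ≤ L) (ζ : Fock (Orb (FermionTorus 2 L))), star ζ ⬝ᵥ ζ = 1 →
      c j - A j + μ₀ j * ((star ζ ⬝ᵥ ((totalNumber : Matrix (Finset (Orb (FermionTorus 2 L))) _ ℂ) *ᵥ ζ)).re /
          (L : ℝ) ^ 2 - ν₀ j) +
        κ j * (u j - (star ζ ⬝ᵥ (hubbardTorusTT' L 1 tp U *ᵥ ζ)).re / (L : ℝ) ^ 2) +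
        (orbitState (twistedFlipSpaceGroupUnitary S) ζ
          ((hubbardTorusTT' L 1 tp U - (μ' j : ℂ) • totalNumber) * fermionEmbed (PolySite.toTorusEmb L (hInj L hL)) (X j) -
            fermionEmbed (PolySite.toTorusEmb L (hInj L hL)) (X j) *
              (hubbardTorusTT' L 1 tp U - (μ' j : ℂ) • totalNumber))).re ≤
        (orbitState (twistedFlipSpaceGroupUnitary S) ζ (fermionEmbed (PolySite.toTorusEmb L (hInj L hL))
          (-(fermionEmbed (PolySite.incl h0)
            (localPairAt (insert (0 : Site 2) unitSteps) dWaveFormFactor 0))))).re)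
    (hc' : ∀ j, (c j - Δ j * Cq j - A j + μ₀ j * (n - ν₀ j) + κ j * (u j - ((hi : ℚ) : ℝ))) ^ 2 ≤ ((c' : ℚ) : ℝ)) :
    ObsPairLROCeilingAt tp U n c' := by
  refine ObsPairLROCeilingAt_of_onePoint_charged_twistedFlip_orbitState_gridCells_bound_sq hU hn0 hn2 hE m hm hlo hhi'
    μ' Δ hleft hright (fun j => c j + κ j * (u j - ((hi : ℚ) : ℝ))) A κ (fun _ => ((hi : ℚ) : ℝ)) μ₀ ν₀ Cq hκ
    (fun _ => le_rfl) hS h0 X hXeven hXevenH hXq L₁ hInj ?_ ?_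
  · intro j L _ hL ζ hζ
    convert hbound j L hL ζ hζ using 1
    ring
  · intro j
    convert hc' j using 2
    ring

/-- **TWISTED OP1-C CELL LEAF, RE-PRICED under ANY certified cap** (spin-resolved filling rows).
[cite: KomaTasaki1994, Theorem 5] [cite: Ruelle1969, §3.4] -/
theorem ObsPairLROCeilingAt_of_onePoint_charged_twisted_orbitState_gridCells_bound_sq_reprice (hU : 0 ≤ U)
    (hn0 : 0 < n) (hn2 : n < 2) (hE : energyDensityTT' 1 tp U n ≤ ((hi : ℚ) : ℝ)) {J : ℕ} (m : Fin (J + 2) → ℝ)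
    (hm : Monotone m) (hlo : m 0 ≤ chemPotMinusTT' 1 tp U n) (hhi' : chemPotPlusTT' 1 tp U n ≤ m (Fin.last (J + 1)))
    (μ' Δ : Fin (J + 1) → ℝ) (hleft : ∀ j, μ' j - Δ j ≤ m j.castSucc) (hright : ∀ j, m j.succ ≤ μ' j + Δ j)
    (c A κ u ν Cq : Fin (J + 1) → ℝ) (μ : Fin (J + 1) → Fin 2 → ℝ) (hκ : ∀ j, 0 ≤ κ j)
    {S : Finset (DihedralGroup 4)} (hS : S.Nonempty)
    {Λ' : Finset (Site 2)} (h0 : pairRegion (insert (0 : Site 2) unitSteps) 0 ⊆ Λ')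
    (X : Fin (J + 1) → FermionOp Λ')
    (hXeven : ∀ j, X j ∈ carEvenSubalgebra (Finset.univ : Finset (Orb (PolySite Λ'))))
    (hXevenH : ∀ j, (X j)ᴴ ∈ carEvenSubalgebra (Finset.univ : Finset (Orb (PolySite Λ'))))
    (hXq : ∀ j, ‖(totalNumberOp : FermionOp Λ') * X j - X j * totalNumberOp‖ ≤ Cq j) (L₁ : ℕ)
    (hInj : ∀ L : ℕ, L₁ ≤ L → Set.InjOn (Torus.proj (d := 2) L) ↑Λ')
    (hbound : ∀ j, ∀ (L : ℕ) [NeZero L] (hL : L₁ ≤ L) (ζ : Fock (Orb (FermionTorus 2 L))), star ζ ⬝ᵥ ζ = 1 →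
      c j - A j + ∑ σ : Fin 2, μ j σ *
          ((star ζ ⬝ᵥ ((∑ y : FermionTorus 2 L, numberOp y σ) *ᵥ ζ)).re / (L : ℝ) ^ 2 - ν j) +
        κ j * (u j - (star ζ ⬝ᵥ (hubbardTorusTT' L 1 tp U *ᵥ ζ)).re / (L : ℝ) ^ 2) +
        (orbitState (twistedSpaceGroupUnitary S) ζ
          ((hubbardTorusTT' L 1 tp U - (μ' j : ℂ) • totalNumber) * fermionEmbed (PolySite.toTorusEmb L (hInj L hL)) (X j) -
            fermionEmbed (PolySite.toTorusEmb L (hInj L hL)) (X j) *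
              (hubbardTorusTT' L 1 tp U - (μ' j : ℂ) • totalNumber))).re ≤
        (orbitState (twistedSpaceGroupUnitary S) ζ (fermionEmbed (PolySite.toTorusEmb L (hInj L hL))
          (-(fermionEmbed (PolySite.incl h0)
            (localPairAt (insert (0 : Site 2) unitSteps) dWaveFormFactor 0))))).re)
    (hc' : ∀ j, (c j - Δ j * Cq j - A j + (∑ σ : Fin 2, μ j σ) * (n / 2 - ν j) + κ j * (u j - ((hi : ℚ) : ℝ))) ^ 2 ≤
      ((c' : ℚ) : ℝ)) :
    ObsPairLROCeilingAt tp U n c' := by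
  refine ObsPairLROCeilingAt_of_onePoint_charged_twisted_orbitState_gridCells_bound_sq hU hn0 hn2 hE m hm hlo hhi'
    μ' Δ hleft hright (fun j => c j + κ j * (u j - ((hi : ℚ) : ℝ))) A κ (fun _ => ((hi : ℚ) : ℝ)) ν Cq μ hκ
    (fun _ => le_rfl) hS h0 X hXeven hXevenH hXq L₁ hInj ?_ ?_
  · intro j L _ hL ζ hζ
    convert hbound j L hL ζ hζ using 1
    ring
  · intro j
    convert hc' j using 2
    ring


/-! ### §4 (append) EXACT-IN-THE-CELL nodes (the δ-LIFT form): no interval slack -/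

/-- **FLIP-TWISTED OP1-C CELL LEAF from nodes valid at EVERY chemical potential of their cell** (the form a δ-LIFTED
cell certificate delivers, sr-mbsolver-menu-3 MENU3-TLPINCER §8.5: for each cell `j` and every `μ_c ∈ [m j, m (j+1)]`
the flip-twisted OP1-C node holds with the charged row AT `μ_c` and CELL-CONSTANT data `c_j, A_j, κ_j, μ₀_j, ν₀_j, X_j`).
No `C_q`, no `Δ`: conclusion `ObsPairLROCeilingAt t′ U n c′` at every `c′ ≥ max_j (c_j − A_j + μ₀_j(n − ν₀_j))²`
(the `_near` reader at `Δ = 0`). [cite: KomaTasaki1994, Theorem 5] [cite: Ruelle1969, §3.4] [cite: LiebWuPhysicaA2003, §7] -/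
theorem ObsPairLROCeilingAt_of_onePoint_charged_twistedFlip_orbitState_exactCells_bound_sq (hU : 0 ≤ U)
    (hn0 : 0 < n) (hn2 : n < 2) (hE : energyDensityTT' 1 tp U n ≤ ((hi : ℚ) : ℝ)) {J : ℕ} (m : Fin (J + 2) → ℝ)
    (hm : Monotone m) (hlo : m 0 ≤ chemPotMinusTT' 1 tp U n) (hhi' : chemPotPlusTT' 1 tp U n ≤ m (Fin.last (J + 1)))
    (c A κ u μ₀ ν₀ : Fin (J + 1) → ℝ) (hκ : ∀ j, 0 ≤ κ j) (hhi : ∀ j, ((hi : ℚ) : ℝ) ≤ u j)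
    {S : Finset (DihedralGroup 4)} (hS : S.Nonempty)
    {Λ' : Finset (Site 2)} (h0 : pairRegion (insert (0 : Site 2) unitSteps) 0 ⊆ Λ')
    (X : Fin (J + 1) → FermionOp Λ')
    (hXeven : ∀ j, X j ∈ carEvenSubalgebra (Finset.univ : Finset (Orb (PolySite Λ'))))
    (hXevenH : ∀ j, (X j)ᴴ ∈ carEvenSubalgebra (Finset.univ : Finset (Orb (PolySite Λ')))) (L₁ : ℕ)
    (hInj : ∀ L : ℕ, L₁ ≤ L → Set.InjOn (Torus.proj (d := 2) L) ↑Λ')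
    (hbound : ∀ j, ∀ μc ∈ Set.Icc (m j.castSucc) (m j.succ),
      ∀ (L : ℕ) [NeZero L] (hL : L₁ ≤ L) (ζ : Fock (Orb (FermionTorus 2 L))), star ζ ⬝ᵥ ζ = 1 →
      c j - A j + μ₀ j * ((star ζ ⬝ᵥ ((totalNumber : Matrix (Finset (Orb (FermionTorus 2 L))) _ ℂ) *ᵥ ζ)).re /
          (L : ℝ) ^ 2 - ν₀ j) +
        κ j * (u j - (star ζ ⬝ᵥ (hubbardTorusTT' L 1 tp U *ᵥ ζ)).re / (L : ℝ) ^ 2) +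
        (orbitState (twistedFlipSpaceGroupUnitary S) ζ
          ((hubbardTorusTT' L 1 tp U - (μc : ℂ) • totalNumber) * fermionEmbed (PolySite.toTorusEmb L (hInj L hL)) (X j) -
            fermionEmbed (PolySite.toTorusEmb L (hInj L hL)) (X j) *
              (hubbardTorusTT' L 1 tp U - (μc : ℂ) • totalNumber))).re ≤
        (orbitState (twistedFlipSpaceGroupUnitary S) ζ (fermionEmbed (PolySite.toTorusEmb L (hInj L hL))
          (-(fermionEmbed (PolySite.incl h0)
            (localPairAt (insert (0 : Site 2) unitSteps) dWaveFormFactor 0))))).re)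
    (hc' : ∀ j, (c j - A j + μ₀ j * (n - ν₀ j)) ^ 2 ≤ ((c' : ℚ) : ℝ)) :
    ObsPairLROCeilingAt tp U n c' := by
  have hmp := chemPotMinusTT'_le_chemPotPlusTT' 1 tp hU hn0 hn2
  obtain ⟨j, hj⟩ := exists_mem_Icc_castSucc_succ_of_monotone hm
    (x := chemPotMinusTT' 1 tp U n) ⟨hlo, hmp.trans hhi'⟩
  have hnear : |chemPotMinusTT' 1 tp U n - chemPotMinusTT' 1 tp U n| ≤ 0 := by rw [sub_self, abs_zero]
  intro ψ hψ hψ1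
  have h := liminf_pairFieldLRO_le_sq_of_onePoint_chargedStationary_twistedFlip_orbitState_bound_TT'_near 1 tp hU hn0
    hn2 (hκ j) (hE.trans (hhi j)) ⟨le_rfl, hmp⟩ hnear hS h0 (X j) (hXeven j) (hXevenH j)
    (le_refl ‖(totalNumberOp : FermionOp Λ') * X j - X j * totalNumberOp‖) L₁ hInj (hbound j _ hj) ψ hψ hψ1
  rw [zero_mul, sub_zero] at h
  exact h.trans (hc' j)


/-- **TWISTED OP1-C CELL LEAF from nodes valid at EVERY chemical potential of their cell** (δ-LIFT form, twisted `D₄`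
family, spin-resolved filling rows): leaf at every `c′ ≥ max_j (c_j − A_j + (Σ_σ μ_{jσ})(n/2 − ν_j))²`, no `Δ·C_q`.
[cite: KomaTasaki1994, Theorem 5] [cite: Ruelle1969, §3.4] [cite: LiebWuPhysicaA2003, §7] -/
theorem ObsPairLROCeilingAt_of_onePoint_charged_twisted_orbitState_exactCells_bound_sq (hU : 0 ≤ U)
    (hn0 : 0 < n) (hn2 : n < 2) (hE : energyDensityTT' 1 tp U n ≤ ((hi : ℚ) : ℝ)) {J : ℕ} (m : Fin (J + 2) → ℝ)
    (hm : Monotone m) (hlo : m 0 ≤ chemPotMinusTT' 1 tp U n) (hhi' : chemPotPlusTT' 1 tp U n ≤ m (Fin.last (J + 1)))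
    (c A κ u ν : Fin (J + 1) → ℝ) (μ : Fin (J + 1) → Fin 2 → ℝ) (hκ : ∀ j, 0 ≤ κ j) (hhi : ∀ j, ((hi : ℚ) : ℝ) ≤ u j)
    {S : Finset (DihedralGroup 4)} (hS : S.Nonempty)
    {Λ' : Finset (Site 2)} (h0 : pairRegion (insert (0 : Site 2) unitSteps) 0 ⊆ Λ')
    (X : Fin (J + 1) → FermionOp Λ')
    (hXeven : ∀ j, X j ∈ carEvenSubalgebra (Finset.univ : Finset (Orb (PolySite Λ'))))
    (hXevenH : ∀ j, (X j)ᴴ ∈ carEvenSubalgebra (Finset.univ : Finset (Orb (PolySite Λ')))) (L₁ : ℕ)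
    (hInj : ∀ L : ℕ, L₁ ≤ L → Set.InjOn (Torus.proj (d := 2) L) ↑Λ')
    (hbound : ∀ j, ∀ μc ∈ Set.Icc (m j.castSucc) (m j.succ),
      ∀ (L : ℕ) [NeZero L] (hL : L₁ ≤ L) (ζ : Fock (Orb (FermionTorus 2 L))), star ζ ⬝ᵥ ζ = 1 →
      c j - A j + ∑ σ : Fin 2, μ j σ *
          ((star ζ ⬝ᵥ ((∑ y : FermionTorus 2 L, numberOp y σ) *ᵥ ζ)).re / (L : ℝ) ^ 2 - ν j) +
        κ j * (u j - (star ζ ⬝ᵥ (hubbardTorusTT' L 1 tp U *ᵥ ζ)).re / (L : ℝ) ^ 2) +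
        (orbitState (twistedSpaceGroupUnitary S) ζ
          ((hubbardTorusTT' L 1 tp U - (μc : ℂ) • totalNumber) * fermionEmbed (PolySite.toTorusEmb L (hInj L hL)) (X j) -
            fermionEmbed (PolySite.toTorusEmb L (hInj L hL)) (X j) *
              (hubbardTorusTT' L 1 tp U - (μc : ℂ) • totalNumber))).re ≤
        (orbitState (twistedSpaceGroupUnitary S) ζ (fermionEmbed (PolySite.toTorusEmb L (hInj L hL))
          (-(fermionEmbed (PolySite.incl h0)
            (localPairAt (insert (0 : Site 2) unitSteps) dWaveFormFactor 0))))).re)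
    (hc' : ∀ j, (c j - A j + (∑ σ : Fin 2, μ j σ) * (n / 2 - ν j)) ^ 2 ≤ ((c' : ℚ) : ℝ)) :
    ObsPairLROCeilingAt tp U n c' := by
  have hmp := chemPotMinusTT'_le_chemPotPlusTT' 1 tp hU hn0 hn2
  obtain ⟨j, hj⟩ := exists_mem_Icc_castSucc_succ_of_monotone hm
    (x := chemPotMinusTT' 1 tp U n) ⟨hlo, hmp.trans hhi'⟩
  have hnear : |chemPotMinusTT' 1 tp U n - chemPotMinusTT' 1 tp U n| ≤ 0 := by rw [sub_self, abs_zero]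
  intro ψ hψ hψ1
  have h := liminf_pairFieldLRO_le_sq_of_onePoint_chargedStationary_twisted_orbitState_bound_TT'_near 1 tp hU hn0 hn2
    (μ j) (hκ j) (hE.trans (hhi j)) ⟨le_rfl, hmp⟩ hnear hS h0 (X j) (hXeven j) (hXevenH j)
    (le_refl ‖(totalNumberOp : FermionOp Λ') * X j - X j * totalNumberOp‖) L₁ hInj (hbound j _ hj) ψ hψ hψ1
  rw [zero_mul, sub_zero] at h
  exact h.trans (hc' j)

end LeafCellsTwisted

end Summit.Ventures.CertifiedManyBodySolver.Observables

end
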